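import Summits.SmoothPoincare4.SmoothPoincare4.Theorems.SymplecticOrigamiOrigamiFoldExistenceShadowPleatsCleanDefs
import Summits.SmoothPoincare4.SmoothPoincare4.Theorems.SymplecticOrigamiOrigamiFoldExistenceStubPleatFreeStandardSheets
import Literature.Topology.FourManifolds.HomotopyS4CompactProofs

/-!
# Stub `stub_cleanOnePleatIroning` of line `shadow-pleats` for crux `OrigamiFoldExistence` — I:
# vertical modifications of a position (item stmt-SmoothPoincare4-7844, route SymplecticOrigami; seat c3, S5a worker)

First helper file for the registered stub `stub_cleanOnePleatIroning` (S5a, CLEAN ONE-PLEAT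
IRONING: a homotopy `4`-sphere with a clean `1`-pleat round-rim shadow position has a pleat-free
one) and for its sibling `stub_onePleatUnthreading` (S5b).  Both paper proofs move sheets of the
hypersurface `ι(M) ⊂ ℝ⁵ = ℝ⁴ × ℝ` VERTICALLY before (S5a) or instead of (S5b, c2's Prop. A′)
cutting: this file lands, once, the bookkeeping of a VERTICAL MODIFICATION

  `vshift ι ψ m = ι m + ψ m • e₄`      (`ψ : M → ℝ` smooth)

of an embedding `ι : M → ℝ⁵` over the line vocabulary (`proj5`, `e4`, `IsPleatedPosition`,
`IsCleanPleat`; Defs/CleanDefs/Shadow files):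

* the SHADOW is unchanged (`proj5_vshift`, `proj5_comp_vshift`), hence so are its differential
  (`mfderiv_shadow_vshift`), the fold clause and cleanness (`IsCleanPleat.vshift`);
* `vshift ι ψ` is smooth; where the shadow is immersive it is immersive
  (`injective_mfderiv_vshift_of_shadow`), and off the support of `ψ` it has the differential of
  `ι` (`mfderiv_vshift_of_notMem_tsupport`);
* INJECTIVITY ⟸ ORDER-COMPATIBILITY over common shadows (`injective_vshift_of_order`): two points
  with the same shadow keep the order of their heights;
* on a COMPACT `M` a smooth injective `vshift` with injective differential is a `C^∞` embedding
  (`isSmoothEmbedding_vshift`, Hirsch's criterion = the tree's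
  `Literature.Topology.FourManifolds.isSmoothEmbedding_of_injective_of_injective_mfderiv`);
* the ROUND CLAUSE survives a modification supported above the plane that stays above the plane
  (`round_vshift`), and so does the whole of `IsPleatedPosition` (`IsPleatedPosition.vshift`:
  same `δ`, same charts `e`; the only new obligation is immersivity AT THE FOLD SPHERES inside
  the support, where a vertical push can create a vertical cusp), and `HasCleanPleatedPosition`
  (`hasCleanPleatedPosition_vshift`).  Compactness of a homotopy `4`-sphere is the tree's
  `compactSpace_of_homotopyEquiv_sphere_four_holds`.

What a vertical modification can NOT do: remove a pleat — the shadow, hence its fold locus, is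
literally unchanged (`mfderiv_shadow_vshift`); the deletion step of S5a re-parametrises the
pleat ball over its shadow (files II–III).

Sources: Disproof.lean §7c (γ) (deletion lemma), W-Morse-analysis-c2.md §1.4/§5 (vertical
rearrangement); Hirsch, *Differential Topology* (1976) Ch. 1 §3 Thm. 3.1.
-/

noncomputable section

-- the prescribed namespace `Summit.<P>.<Sub>.…` duplicates `SmoothPoincare4` (P = Sub)
set_option linter.dupNamespace false

open scoped Manifold ContDiff Topology
open Set Function Filter Metric ContinuousMap

namespace Summit.SmoothPoincare4.SmoothPoincare4.Theorems.OrigamiFoldExistence.ShadowPleats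

/-! ### Vertical modifications: definition and shadow -/

/-- The VERTICAL MODIFICATION of a map `ι : M → ℝ⁵` by a height increment `ψ : M → ℝ`:
`m ↦ ι m + ψ m • e₄` (same shadow, height `ι m 4 + ψ m`). -/
def vshift {M : Type} (ι : M → EuclideanSpace ℝ (Fin 5)) (ψ : M → ℝ) (m : M) :
    EuclideanSpace ℝ (Fin 5) :=
  ι m + ψ m • e4

section Algebra

variable {M : Type} {ι : M → EuclideanSpace ℝ (Fin 5)} {ψ : M → ℝ}

/-- Unfolding lemma. -/
theorem vshift_apply (m : M) : vshift ι ψ m = ι m + ψ m • e4 := rfl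

/-- A vertical modification does not change the shadow. [folklore] -/
@[simp] theorem proj5_vshift (m : M) : proj5 (vshift ι ψ m) = proj5 (ι m) := by
  rw [vshift_apply, proj5_add, proj5_smul, proj5_e4, smul_zero, add_zero]

/-- A vertical modification does not change the shadow map. [folklore] -/
theorem proj5_comp_vshift : proj5 ∘ vshift ι ψ = proj5 ∘ ι :=
  funext proj5_vshift

/-- The height of a vertical modification. [folklore] -/
@[simp] theorem vshift_apply_four (m : M) : vshift ι ψ m 4 = ι m 4 + ψ m := by
  simp [vshift_apply, e4]

/-- Where the increment vanishes the modification is `ι`. -/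
theorem vshift_eq_of_eq_zero {m : M} (h : ψ m = 0) : vshift ι ψ m = ι m := by
  rw [vshift_apply, h, zero_smul, add_zero]

/-- The zero modification is `ι`. -/
@[simp] theorem vshift_zero : vshift ι (fun _ => (0 : ℝ)) = ι :=
  funext fun _ => vshift_eq_of_eq_zero rfl

/-- Two points of `ℝ⁵` with the same shadow and the same height coincide. [folklore] -/
theorem eq_of_proj5_eq_of_apply_four_eq {p q : EuclideanSpace ℝ (Fin 5)} (hs : proj5 p = proj5 q)
    (hh : p 4 = q 4) : p = q := by
  rw [← embedL_proj5_add_smul p, ← embedL_proj5_add_smul q, hs, hh]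

/-- **Injectivity from order-compatibility.** If `ι` is injective and the modified heights of
any two points with a common shadow are ordered like the old ones, the vertical modification is
injective. [folklore] -/
theorem injective_vshift_of_order (hι : Injective ι)
    (hord : ∀ m m' : M, proj5 (ι m) = proj5 (ι m') → ι m 4 < ι m' 4 →
      ι m 4 + ψ m < ι m' 4 + ψ m') :
    Injective (vshift ι ψ) := by
  intro m m' h
  have hs : proj5 (ι m) = proj5 (ι m') := by
    rw [← proj5_vshift (ψ := ψ) m, ← proj5_vshift (ψ := ψ) m', h]
  have hh : ι m 4 + ψ m = ι m' 4 + ψ m' := by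
    rw [← vshift_apply_four, ← vshift_apply_four, h]
  rcases lt_trichotomy (ι m 4) (ι m' 4) with hlt | heq | hgt
  · exact absurd hh (hord m m' hs hlt).ne
  · exact hι (eq_of_proj5_eq_of_apply_four_eq hs heq)
  · exact absurd hh.symm (hord m' m hs.symm hgt).ne

/-- **The round clause survives** a vertical modification which is supported strictly above the
plane `h = 1 - δ` and keeps the moved points strictly above it. [folklore] -/
theorem round_vshift {δ : ℝ}
    (hround : Set.range ι ∩ {p : EuclideanSpace ℝ (Fin 5) | p 4 ≤ 1 - δ} =
      (Metric.sphere (0 : EuclideanSpace ℝ (Fin 5)) 1 : Set (EuclideanSpace ℝ (Fin 5))) ∩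
        {p : EuclideanSpace ℝ (Fin 5) | p 4 ≤ 1 - δ})
    (hsupp : ∀ m, ψ m ≠ 0 → 1 - δ < ι m 4) (habove : ∀ m, ψ m ≠ 0 → 1 - δ < ι m 4 + ψ m) :
    Set.range (vshift ι ψ) ∩ {p : EuclideanSpace ℝ (Fin 5) | p 4 ≤ 1 - δ} =
      (Metric.sphere (0 : EuclideanSpace ℝ (Fin 5)) 1 : Set (EuclideanSpace ℝ (Fin 5))) ∩
        {p : EuclideanSpace ℝ (Fin 5) | p 4 ≤ 1 - δ} := by
  ext p
  constructor
  · rintro ⟨⟨m, rfl⟩, hp⟩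
    have hp' : ι m 4 + ψ m ≤ 1 - δ := by simpa using hp
    have h0 : ψ m = 0 := by
      by_contra h
      exact absurd hp' (not_le.2 (habove m h))
    have : ι m ∈ Set.range ι ∩ {p : EuclideanSpace ℝ (Fin 5) | p 4 ≤ 1 - δ} :=
      ⟨mem_range_self m, by simpa [h0] using hp'⟩
    rw [hround] at this
    rw [vshift_eq_of_eq_zero h0]
    exact this
  · rintro ⟨hpS, hp⟩
    have : p ∈ Set.range ι ∩ {p : EuclideanSpace ℝ (Fin 5) | p 4 ≤ 1 - δ} := by
      rw [hround]; exact ⟨hpS, hp⟩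
    obtain ⟨⟨m, rfl⟩, hm⟩ := this
    have hm' : ι m 4 ≤ 1 - δ := hm
    have h0 : ψ m = 0 := by
      by_contra h
      exact absurd hm' (not_le.2 (hsupp m h))
    exact ⟨⟨m, vshift_eq_of_eq_zero h0⟩, hp⟩

/-- Cleanness is a property of the shadow alone, so it survives vertical modifications. -/
theorem IsCleanPleat.vshift {e : EuclideanSpace ℝ (Fin 4) → M} (h : IsCleanPleat ι e) :
    IsCleanPleat (vshift ι ψ) e := by
  have heq : proj5 ∘ ShadowPleats.vshift ι ψ ∘ e = proj5 ∘ ι ∘ e := by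
    rw [← Function.comp_assoc, proj5_comp_vshift, Function.comp_assoc]
  unfold IsCleanPleat
  rw [heq]
  exact h

end Algebra

/-! ### Smoothness and differentials -/

section Smooth

variable {M : Type} [TopologicalSpace M] [ChartedSpace (EuclideanSpace ℝ (Fin 4)) M]
  {ι : M → EuclideanSpace ℝ (Fin 5)} {ψ : M → ℝ}

/-- A vertical modification of a smooth map by a smooth increment is smooth. [folklore] -/
theorem contMDiff_vshift (hι : ContMDiff (𝓡 4) (𝓡 5) ∞ ι) (hψ : ContMDiff (𝓡 4) 𝓘(ℝ, ℝ) ∞ ψ) :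
    ContMDiff (𝓡 4) (𝓡 5) ∞ (vshift ι ψ) := by
  have hF : ContDiff ℝ ∞ fun p : EuclideanSpace ℝ (Fin 5) × ℝ => p.1 + p.2 • e4 :=
    contDiff_fst.add (contDiff_snd.smul contDiff_const)
  have hcomp := hF.comp_contMDiff (hι.prodMk_space hψ)
  exact hcomp

/-- The height `m ↦ vshift ι ψ m 4 = ι m 4 + ψ m` is continuous. -/
theorem continuous_vshift_apply_four (hι : ContMDiff (𝓡 4) (𝓡 5) ∞ ι)
    (hψ : ContMDiff (𝓡 4) 𝓘(ℝ, ℝ) ∞ ψ) : Continuous fun m => vshift ι ψ m 4 := by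
  have : Continuous fun m => heightL (vshift ι ψ m) :=
    heightL.continuous.comp (contMDiff_vshift hι hψ).continuous
  simpa using this

/-- Chain rule: the differential of the shadow of a smooth map is `proj5L ∘ d(map)`. -/
theorem mfderiv_proj5_comp {f : M → EuclideanSpace ℝ (Fin 5)} (hf : ContMDiff (𝓡 4) (𝓡 5) ∞ f)
    (m : M) :
    mfderiv (𝓡 4) (𝓡 4) (proj5 ∘ f) m =
      (proj5L : EuclideanSpace ℝ (Fin 5) →L[ℝ] EuclideanSpace ℝ (Fin 4)).comp
        (mfderiv (𝓡 4) (𝓡 5) f m) := by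
  have hval : HasMFDerivAt (𝓡 4) (𝓡 5) f m (mfderiv (𝓡 4) (𝓡 5) f m) :=
    ((hf m).mdifferentiableAt (by simp)).hasMFDerivAt
  have hproj : HasMFDerivAt 𝓘(ℝ, EuclideanSpace ℝ (Fin 5)) 𝓘(ℝ, EuclideanSpace ℝ (Fin 4))
      (proj5L : EuclideanSpace ℝ (Fin 5) → EuclideanSpace ℝ (Fin 4)) (f m) proj5L :=
    proj5L.hasMFDerivAt
  have hcomp := hproj.comp m hval
  rw [← coe_proj5L]
  exact hcomp.mfderiv

/-- **The differential of the shadow is unchanged** by a vertical modification (the shadow map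
is literally the same function). [folklore] -/
theorem mfderiv_shadow_vshift (m : M) :
    mfderiv (𝓡 4) (𝓡 4) (proj5 ∘ vshift ι ψ) m = mfderiv (𝓡 4) (𝓡 4) (proj5 ∘ ι) m := by
  rw [proj5_comp_vshift]

/-- **Where the shadow is immersive, every smooth vertical modification is immersive**: an
injective `d(proj5 ∘ ι)_m = proj5L ∘ d(vshift ι ψ)_m` forces `d(vshift ι ψ)_m` injective. -/
theorem injective_mfderiv_vshift_of_shadow (hι : ContMDiff (𝓡 4) (𝓡 5) ∞ ι)
    (hψ : ContMDiff (𝓡 4) 𝓘(ℝ, ℝ) ∞ ψ) {m : M}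
    (hinj : Injective (mfderiv (𝓡 4) (𝓡 4) (proj5 ∘ ι) m)) :
    Injective (mfderiv (𝓡 4) (𝓡 5) (vshift ι ψ) m) := by
  have heq : mfderiv (𝓡 4) (𝓡 4) (proj5 ∘ ι) m =
      (proj5L : EuclideanSpace ℝ (Fin 5) →L[ℝ] EuclideanSpace ℝ (Fin 4)).comp
        (mfderiv (𝓡 4) (𝓡 5) (vshift ι ψ) m) := by
    rw [← mfderiv_shadow_vshift (ψ := ψ), mfderiv_proj5_comp (contMDiff_vshift hι hψ)]
  intro v₁ v₂ h
  apply hinj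
  rw [heq]
  exact congrArg proj5L h

/-- Off the (topological) support of the increment the modification agrees with `ι` near the
point, so the differentials agree. [folklore] -/
theorem mfderiv_vshift_of_notMem_tsupport {m : M} (hm : m ∉ tsupport ψ) :
    mfderiv (𝓡 4) (𝓡 5) (vshift ι ψ) m = mfderiv (𝓡 4) (𝓡 5) ι m := by
  have h0 : ψ =ᶠ[𝓝 m] 0 := notMem_tsupport_iff_eventuallyEq.1 hm
  have heq : vshift ι ψ =ᶠ[𝓝 m] ι := by
    filter_upwards [h0] with m' hm'
    exact vshift_eq_of_eq_zero hm'
  exact heq.mfderiv_eq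

/-- Off the support of the increment, immersivity of `ι` passes to the modification. -/
theorem injective_mfderiv_vshift_of_notMem_tsupport (hι : Manifold.IsSmoothEmbedding (𝓡 4) (𝓡 5) ∞ ι)
    {m : M} (hm : m ∉ tsupport ψ) : Injective (mfderiv (𝓡 4) (𝓡 5) (vshift ι ψ) m) := by
  rw [mfderiv_vshift_of_notMem_tsupport hm]
  exact injective_mfderiv_of_emb hι m

/-- **A smooth, injective, immersive vertical modification of an embedding of a COMPACT manifold
is a `C^∞` embedding** (Hirsch's criterion, the tree's
`isSmoothEmbedding_of_injective_of_injective_mfderiv`). [folklore] -/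
theorem isSmoothEmbedding_vshift [IsManifold (𝓡 4) ∞ M] [CompactSpace M] (hι : ContMDiff (𝓡 4) (𝓡 5) ∞ ι)
    (hψ : ContMDiff (𝓡 4) 𝓘(ℝ, ℝ) ∞ ψ) (hinj : Injective (vshift ι ψ))
    (hd : ∀ m, Injective (mfderiv (𝓡 4) (𝓡 5) (vshift ι ψ) m)) :
    Manifold.IsSmoothEmbedding (𝓡 4) (𝓡 5) ∞ (vshift ι ψ) :=
  Literature.Topology.FourManifolds.isSmoothEmbedding_of_injective_of_injective_mfderiv
    (contMDiff_vshift hι hψ) (by simp) hinj hd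

end Smooth

/-! ### Vertical modifications of pleated positions -/

section Pleated

variable {M : Type} [TopologicalSpace M] [ChartedSpace (EuclideanSpace ℝ (Fin 4)) M]
  {ι : M → EuclideanSpace ℝ (Fin 5)} {ψ : M → ℝ} {δ : ℝ} {k : ℕ}
  {e : Fin k → EuclideanSpace ℝ (Fin 4) → M}

/-- **Vertical modification of a pleated position** (same `δ`, same pleat charts).  Hypotheses on
the smooth increment `ψ`: supported strictly above the plane (`tsupport ψ ⊆ {h > 1 - δ}`), moved
points stay strictly above the plane, ORDER-COMPATIBLE over common shadows (so the result is
injective), and — the only differential obligation a vertical push creates — the modified map is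
still immersive at the fold-sphere points inside the support (elsewhere above the plane the
shadow is immersive, and a vertical push cannot create a vertical kernel).  Conclusion: the
modification is again a pleated round-rim shadow position with the same charts; its shadow, fold
spheres and fold clause are literally those of `ι`. [folklore] -/
theorem IsPleatedPosition.vshift [IsManifold (𝓡 4) ∞ M] [CompactSpace M]
    (h : IsPleatedPosition ι δ e)
    (hψ : ContMDiff (𝓡 4) 𝓘(ℝ, ℝ) ∞ ψ) (hts : tsupport ψ ⊆ {m : M | 1 - δ < ι m 4})
    (habove : ∀ m, 1 - δ < ι m 4 → 1 - δ < ι m 4 + ψ m)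
    (hord : ∀ m m' : M, proj5 (ι m) = proj5 (ι m') → ι m 4 < ι m' 4 →
      ι m 4 + ψ m < ι m' 4 + ψ m')
    (hfold : ∀ j, ∀ u ∈ pleatSpheres, e j u ∈ tsupport ψ →
      Injective (mfderiv (𝓡 4) (𝓡 5) (ShadowPleats.vshift ι ψ) (e j u))) :
    IsPleatedPosition (ShadowPleats.vshift ι ψ) δ e := by
  obtain ⟨hι, hδ0, hδ1, hround, hcharts, hdisj, hinj, hfoldι⟩ := h
  have hsupp : ∀ m, ψ m ≠ 0 → 1 - δ < ι m 4 := fun m hm =>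
    hts (subset_tsupport ψ (Function.mem_support.2 hm))
  -- the differential is injective everywhere
  have hd : ∀ m, Injective (mfderiv (𝓡 4) (𝓡 5) (ShadowPleats.vshift ι ψ) m) := by
    intro m
    by_cases hm : m ∈ tsupport ψ
    · by_cases hmem : m ∈ ⋃ j, e j '' pleatSpheres
      · simp only [Set.mem_iUnion, Set.mem_image] at hmem
        obtain ⟨j, u, hu, rfl⟩ := hmem
        exact hfold j u hu hm
      · exact injective_mfderiv_vshift_of_shadow hι.contMDiff hψ (hinj m (hts hm) hmem)
    · exact injective_mfderiv_vshift_of_notMem_tsupport hι hm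
  refine ⟨isSmoothEmbedding_vshift hι.contMDiff hψ
      (injective_vshift_of_order hι.isEmbedding.injective hord) hd, hδ0, hδ1,
    round_vshift hround hsupp (fun m hm => habove m (hsupp m hm)), ?_, hdisj, ?_, ?_⟩
  · -- pleat charts: unchanged, and still strictly above the plane
    intro j
    refine ⟨(hcharts j).1, fun u => ?_⟩
    rw [vshift_apply_four]
    exact habove _ ((hcharts j).2 u)
  · -- shadow immersive above the plane off the fold spheres
    intro m hm hnot
    rw [mfderiv_shadow_vshift]
    refine hinj m ?_ hnot
    rw [vshift_apply_four] at hm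
    by_cases h0 : ψ m = 0
    · simpa [h0] using hm
    · exact hsupp m h0
  · -- fold clause: the chart shadow is literally the same map
    intro j u hu
    have heq : proj5 ∘ ShadowPleats.vshift ι ψ ∘ e j = proj5 ∘ ι ∘ e j := by
      rw [← Function.comp_assoc, proj5_comp_vshift, Function.comp_assoc]
    rw [heq]
    exact hfoldι j u hu

/-- **Clean pleated positions are stable under vertical modification** (bundled form, for the
ladder's rungs S5a/S5b): under the hypotheses of `IsPleatedPosition.vshift`, a clean `k`-pleat
position `(ι, δ, e)` of a compact `M` yields the clean `k`-pleat position `(vshift ι ψ, δ, e)`.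
[folklore] -/
theorem hasCleanPleatedPosition_vshift [IsManifold (𝓡 4) ∞ M] [CompactSpace M]
    (h : IsPleatedPosition ι δ e)
    (hclean : ∀ j, IsCleanPleat ι (e j))
    (hψ : ContMDiff (𝓡 4) 𝓘(ℝ, ℝ) ∞ ψ) (hts : tsupport ψ ⊆ {m : M | 1 - δ < ι m 4})
    (habove : ∀ m, 1 - δ < ι m 4 → 1 - δ < ι m 4 + ψ m)
    (hord : ∀ m m' : M, proj5 (ι m) = proj5 (ι m') → ι m 4 < ι m' 4 →
      ι m 4 + ψ m < ι m' 4 + ψ m')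
    (hfold : ∀ j, ∀ u ∈ pleatSpheres, e j u ∈ tsupport ψ →
      Injective (mfderiv (𝓡 4) (𝓡 5) (vshift ι ψ) (e j u))) :
    HasCleanPleatedPosition M k :=
  ⟨vshift ι ψ, δ, e, h.vshift hψ hts habove hord hfold, fun j => (hclean j).vshift⟩

/-- The compactness input of the two rungs: a homotopy `4`-sphere is compact (the tree's
discharged fact `compactSpace_of_homotopyEquiv_sphere_four_holds`, Hatcher Prop. 3.29). -/
theorem compactSpace_of_homotopyEquiv_sphere {M : Type} [TopologicalSpace M] [T2Space M]
    [SecondCountableTopology M] [ChartedSpace (EuclideanSpace ℝ (Fin 4)) M] [IsManifold (𝓡 4) ∞ M]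
    (hM : M ≃ₕ (Metric.sphere (0 : EuclideanSpace ℝ (Fin 5)) 1)) : CompactSpace M :=
  Literature.Topology.FourManifolds.compactSpace_of_homotopyEquiv_sphere_four_holds M hM

end Pleated

end Summit.SmoothPoincare4.SmoothPoincare4.Theorems.OrigamiFoldExistence.ShadowPleats

end
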